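import Literature.AnabelianGeometry.EtaleTheta.Discharge.Sec2InducesMuConjCalculus

/-!
# [EtTh] Cor 2.19 (i), subquotients (`RigidData.Cor219_i_subquotients`, FACT-LIST F-0627): under
# Cor 2.18 (iii) the row IS the invariance of the three theta subquotients of `Π^tp_Y` under the
# INDUCED automorphisms — proof-only companion of `ThetaRigidity.lean`

Mochizuki, *The Étale Theta Function and its Frobenioid-theoretic Manifestations* [EtTh],
Publ. RIMS 45 (2009), §2, Cor 2.19 (i) p.64 (proof pp.65–66), Cor 2.18 (i), (iii) pp.60–62
(PDF pages of the PRIMS text; bib key `MochizukiEtTh2009`). PROOF-ONLY (no `def`, no new named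
fact, no instance; nothing of `ThetaRigidity.lean`, seat abc-iut-L2-t2, is edited or restated);
cell `abc-iut`, seat abc-iut-f-148 (F-TRANCHES 148, row F-0627; the universal closure of the row is
refuted at a toy by abc-iut-w5-d175, `ThetaRigiditySchemaWitness.lean`; its instance forms of
record are abc-iut-L2-d1's `cor219_i_subquotients_of` ⟸ F-0620 `Cor218_i` ∧ F-0623
`Cor218_iii_quotient` ∧ F-0622 `Cor218_iii_PiX`, and the §1-model theorems of lane C2).

WHAT IS PROVED (for EVERY `R : RigidData N l`). Print's proof (p.66 l.5–11): "it follows that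
`Ker(Π• ↠ Π•|(Π•_Y)^Θ)` may be constructed as the image via the theta section of
`Ker(Π•_Y ↠ (Π•_Y)^Θ)` … the subquotients … may then be constructed as the inverse images via
`Π•|(Π•_Y)^Θ ↠ (Π•_Y)^Θ` of the subquotients of Corollary 2.18, (i)". In the kernel:

* `map_proj_algImage` — `proj(s^alg(H ∩ Π^tp_Ÿ)) = H ∩ Π^tp_Y` (bookkeeping);
* `Induces.map_comap_thetaKer_of_map_algImage` — NECESSITY: if a model automorphism `α` inducing
  `ᾱ` preserves `s^alg(Ker(Π^tp_Ÿ ↠ (Π^tp_Ÿ)^Θ))` (clause 1 of the row), then `ᾱ` preserves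
  `Ker ↠ Θ` inside `Π^tp_Y`; clauses 2–3 ⟺ `ᾱ(l·Δ_Θ) = l·Δ_Θ`, `ᾱ(Δ^tp_Y) = Δ^tp_Y`
  (`Sec2InducesMuConjCalculus`);
* `map_algImage_thetaKer_eq_of_induces` — SUFFICIENCY of clause 1: if `ᾱ(Ker ↠ Θ) = Ker ↠ Θ` then
  `α(s^alg(Ker ↠ Θ)) = s^alg(Ker ↠ Θ)`, because on `Ker ↠ Θ` the theta and algebraic sections
  coincide (`cocycle_thetaKer`, p.66 "[cf. Proposition 1.3]"), `α` carries `Im s^Θ` to a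
  `μ_N`-conjugate (Def 2.13 (ii)(c)) and `μ_N`-conjugation is trivial over `Δ` — print's step
  (xi) at the `Π^tp_Y`-level, WITHOUT the detour through `Π^tp_X` (no temp-slimness of the
  conjugation action, F-0622, is used);
* `cor219_i_subquotients_of_induced_invariance` — the row HOLDS as soon as every automorphism of
  every model `M(η)` induces an automorphism of `Π^tp_Y` preserving `Ker ↠ Θ`, `l·Δ_Θ`, `Δ^tp_Y`
  (a `Π^tp_Y`-level form of "Cor 2.18 (iii) + Cor 2.18 (i)"; hypothesis-free otherwise);
* **`cor219_i_subquotients_iff_induced_invariance`** — under F-0623 `Cor218_iii_quotient` (so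
  that every automorphism induces one, `exists_induces_iso`), the row `Cor219_i_subquotients` is
  EQUIVALENT to that invariance statement: F-0627 = «the induced automorphisms of `Π^tp_Y`
  preserve the three theta subquotients», nothing more or less.

HONEST FRAMING: a reading/characterisation of a typed interface row, kernel-checked; nothing here
asserts a disputed claim or takes a side on [IUTchIII] Cor 3.12. [EtTh] is refereed; typed ≠
proved.
-/

namespace Literature.AnabelianGeometry.EtaleTheta

universe u

namespace RigidData

variable {N : ℕ+} {l : ℕ} (R : RigidData.{u} N l)

/-! ## Bookkeeping: `proj ∘ s^alg` on subgroups -/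

/-- `proj(s^alg(H ∩ Π^tp_Ÿ)) = H ∩ Π^tp_Y` for `H ⊆ Π^tp_Ÿ`.
[cite: MochizukiEtTh2009, Prop 2.14(i) p.49] -/
theorem map_proj_algImage (H : Subgroup R.PiX) (hH : H ≤ R.PiYdd) :
    (R.algImage H).map (CycEnvelope.proj R.augY R.chi) = H.comap R.PiY.subtype := by
  ext p
  simp only [algImage, Subgroup.map_map, Subgroup.mem_map, Subgroup.mem_subgroupOf,
    Subgroup.mem_comap, Subgroup.coe_subtype, MonoidHom.coe_comp, Function.comp_apply]
  constructor
  · rintro ⟨q, hq, rfl⟩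
    exact hq
  · intro hp
    exact ⟨⟨p, hH hp⟩, hp, rfl⟩

/-- For an inducing pair `(α, a)`: `proj(α(S)) = a(proj(S))` for every `S ⊆ Π^tp_Y[μ_N]`.
[cite: MochizukiEtTh2009, Prop 2.14(iii) p.49] -/
theorem Induces.map_proj_map {α : MulAut R.env} {a : R.PiY ≃ₜ* R.PiY} (hα : R.Induces α a)
    (S : Subgroup R.env) :
    (S.map α.toMonoidHom).map (CycEnvelope.proj R.augY R.chi) =
      (S.map (CycEnvelope.proj R.augY R.chi)).map a.toMulEquiv.toMonoidHom := by
  rw [Subgroup.map_map, Subgroup.map_map]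
  congr 1
  exact MonoidHom.ext fun x => hα x

variable {R}

/-! ## Necessity: the clauses of the row force the invariances of the induced automorphism -/

/-- **Clause 1 ⇒ `ᾱ(Ker ↠ Θ) = Ker ↠ Θ`**: if `α` induces `a` and preserves
`s^alg(Ker(Π^tp_Ÿ ↠ (Π^tp_Ÿ)^Θ))`, then `a` preserves `Ker ↠ Θ ⊆ Π^tp_Y` (apply `proj`).
[cite: MochizukiEtTh2009, Cor 2.19(i) p.66] -/
theorem Induces.map_comap_thetaKer_of_map_algImage {α : MulAut R.env} {a : R.PiY ≃ₜ* R.PiY}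
    (hα : R.Induces α a)
    (h1 : (R.algImage R.thetaKer).map α.toMonoidHom = R.algImage R.thetaKer) :
    (R.thetaKer.comap R.PiY.subtype).map a.toMulEquiv.toMonoidHom =
      R.thetaKer.comap R.PiY.subtype := by
  have hK : R.thetaKer ≤ R.PiYdd := R.thetaKer_le.trans inf_le_left
  rw [← R.map_proj_algImage R.thetaKer hK, ← hα.map_proj_map, h1]

/-- **Necessity, all three clauses**: if `α ∈ Aut(M(η))` induces `a` and satisfies the three
clauses of `Cor219_i_subquotients`, then `a` preserves `Ker ↠ Θ`, `l·Δ_Θ` and `Δ^tp_Y`.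
[cite: MochizukiEtTh2009, Cor 2.19(i) p.66] -/
theorem Induces.invariance_of_clauses {α : MulAut R.env} {a : R.PiY ≃ₜ* R.PiY}
    (hα : R.Induces α a)
    (h1 : (R.algImage R.thetaKer).map α.toMonoidHom = R.algImage R.thetaKer)
    (h2 : (R.algImage R.lDeltaTheta ⊔ (CycEnvelope.proj R.augY R.chi).ker).map α.toMonoidHom =
      R.algImage R.lDeltaTheta ⊔ (CycEnvelope.proj R.augY R.chi).ker)
    (h3 : (CycEnvelope.deltaEnv R.augY R.chi).map α.toMonoidHom =
      CycEnvelope.deltaEnv R.augY R.chi) :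
    (R.thetaKer.comap R.PiY.subtype).map a.toMulEquiv.toMonoidHom =
        R.thetaKer.comap R.PiY.subtype ∧
      (R.lDeltaTheta.comap R.PiY.subtype).map a.toMulEquiv.toMonoidHom =
        R.lDeltaTheta.comap R.PiY.subtype ∧
      R.augY.ker.map a.toMulEquiv.toMonoidHom = R.augY.ker :=
  ⟨hα.map_comap_thetaKer_of_map_algImage h1,
    (hα.map_algImage_sup_ker_eq_iff R.lDeltaTheta (R.lDeltaTheta_le.trans inf_le_left)).mp h2,
    hα.map_deltaEnv_eq_iff.mp h3⟩

/-! ## Sufficiency of clause 1 at the `Π^tp_Y`-level (print p.66 l.5–7) -/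

/-- The inverse image of `Ker ↠ Θ ∩ Π^tp_Y` lies in `Δ^tp_Y[μ_N]` (`Ker ↠ Θ ⊆ Δ_X`).
[cite: MochizukiEtTh2009, Cor 2.19(i) p.66] -/
theorem comap_thetaKer_le_deltaEnv :
    (R.thetaKer.comap R.PiY.subtype).comap (CycEnvelope.proj R.augY R.chi) ≤
      CycEnvelope.deltaEnv R.augY R.chi := by
  intro x hx
  rw [CycEnvelope.mem_deltaEnv_iff, MonoidHom.mem_ker]
  exact (R.thetaKer_le.trans inf_le_right) hx

/-- **`ᾱ(Ker ↠ Θ) = Ker ↠ Θ` ⇒ clause 1** for automorphisms of a model `M(η)`: `α` preserves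
`s^alg(Ker(Π^tp_Ÿ ↠ (Π^tp_Ÿ)^Θ))` — "the theta and algebraic sections coincide over
`Ker(Π•_Y ↠ (Π•_Y)^Θ)`" (`cocycle_thetaKer`), `α(Im s^Θ)` is a `μ_N`-conjugate of `Im s^Θ`
(Def 2.13 (ii)(c)) and `μ_N`-conjugation is trivial over `Δ`. No temp-slimness is used.
[cite: MochizukiEtTh2009, Cor 2.19(i) p.66] -/
theorem map_algImage_thetaKer_eq_of_induces {η : R.PiYdd → R.mu} {hη : η ∈ R.thetaCocycles}
    (α : (R.modelMono hη).Iso (R.modelMono hη)) {a : R.PiY ≃ₜ* R.PiY}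
    (hα : R.Induces α.e.toMulEquiv a)
    (hK : (R.thetaKer.comap R.PiY.subtype).map a.toMulEquiv.toMonoidHom =
      R.thetaKer.comap R.PiY.subtype) :
    (R.algImage R.thetaKer).map α.e.toMulEquiv.toMonoidHom = R.algImage R.thetaKer := by
  obtain ⟨c, hc⟩ := R.toThetaEnvData.exists_map_range_sTheta_eq α
  -- the inverse image `C` of `Ker ↠ Θ ∩ Π^tp_Y` is preserved by `α` (transfer along `Induces`) …
  have hC : ((R.thetaKer.comap R.PiY.subtype).comap (CycEnvelope.proj R.augY R.chi)).map
      α.e.toMulEquiv.toMonoidHom =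
        (R.thetaKer.comap R.PiY.subtype).comap (CycEnvelope.proj R.augY R.chi) :=
    (hα.map_comap_proj_eq_iff _).mpr hK
  -- … and by `μ_N`-conjugation (it lies in `Δ^tp_Y[μ_N]`)
  have hC' : ((R.thetaKer.comap R.PiY.subtype).comap (CycEnvelope.proj R.augY R.chi)).map
      (MulAut.conj (CycEnvelope.inMu R.augY R.chi c)).toMonoidHom =
        (R.thetaKer.comap R.PiY.subtype).comap (CycEnvelope.proj R.augY R.chi) :=
    R.toThetaEnvData.map_conj_inMu_eq_of_le R.comap_thetaKer_le_deltaEnv c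
  rw [R.algImage_eq_thetaImage hη R.thetaKer (R.cocycle_thetaKer η hη),
    R.thetaImage_eq_range_inf hη R.thetaKer, Subgroup.map_inf_eq _ _ _ α.e.injective, hc, hC]
  conv_lhs => rw [← hC', ← Subgroup.map_inf_eq _ _ _ (MulAut.conj _).injective]
  rw [← R.thetaImage_eq_range_inf hη R.thetaKer]
  exact R.toThetaEnvData.map_conj_inMu_eq_of_le
    (R.thetaImage_le_deltaEnv hη (R.thetaKer_le.trans inf_le_right)) c

/-- **Sufficiency, all three clauses**: an automorphism `α` of `M(η)` inducing an `ᾱ` that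
preserves `Ker ↠ Θ`, `l·Δ_Θ`, `Δ^tp_Y ⊆ Π^tp_Y` satisfies the three clauses of
`Cor219_i_subquotients`. [cite: MochizukiEtTh2009, Cor 2.19(i) p.66] -/
theorem clauses_of_induced_invariance {η : R.PiYdd → R.mu} {hη : η ∈ R.thetaCocycles}
    (α : (R.modelMono hη).Iso (R.modelMono hη)) {a : R.PiY ≃ₜ* R.PiY}
    (hα : R.Induces α.e.toMulEquiv a)
    (hK : (R.thetaKer.comap R.PiY.subtype).map a.toMulEquiv.toMonoidHom =
      R.thetaKer.comap R.PiY.subtype)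
    (hL : (R.lDeltaTheta.comap R.PiY.subtype).map a.toMulEquiv.toMonoidHom =
      R.lDeltaTheta.comap R.PiY.subtype)
    (hΔ : R.augY.ker.map a.toMulEquiv.toMonoidHom = R.augY.ker) :
    (R.algImage R.thetaKer).map α.e.toMulEquiv.toMonoidHom = R.algImage R.thetaKer ∧
      (R.algImage R.lDeltaTheta ⊔ (CycEnvelope.proj R.augY R.chi).ker).map
          α.e.toMulEquiv.toMonoidHom =
        R.algImage R.lDeltaTheta ⊔ (CycEnvelope.proj R.augY R.chi).ker ∧
      (CycEnvelope.deltaEnv R.augY R.chi).map α.e.toMulEquiv.toMonoidHom =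
        CycEnvelope.deltaEnv R.augY R.chi :=
  ⟨map_algImage_thetaKer_eq_of_induces α hα hK,
    (hα.map_algImage_sup_ker_eq_iff R.lDeltaTheta (R.lDeltaTheta_le.trans inf_le_left)).mpr hL,
    hα.map_deltaEnv_eq_iff.mpr hΔ⟩

/-! ## The row, from and as `Π^tp_Y`-level invariance -/

variable (R)

/-- **`Cor219_i_subquotients` from `Π^tp_Y`-level invariance** (no other hypothesis): if every
automorphism of every model `M(η)` induces an automorphism of `Π^tp_Y` preserving
`Ker(Π^tp_Y ↠ (Π^tp_Y)^Θ)`, `l·Δ_Θ` and `Δ^tp_Y`, then the row F-0627 holds for `R`.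
[cite: MochizukiEtTh2009, Cor 2.19(i) p.64] -/
theorem cor219_i_subquotients_of_induced_invariance
    (hY : ∀ (η : R.PiYdd → R.mu) (hη : η ∈ R.thetaCocycles)
      (α : (R.modelMono hη).Iso (R.modelMono hη)),
      ∃ a : R.PiY ≃ₜ* R.PiY, R.Induces α.e.toMulEquiv a ∧
        (R.thetaKer.comap R.PiY.subtype).map a.toMulEquiv.toMonoidHom =
          R.thetaKer.comap R.PiY.subtype ∧
        (R.lDeltaTheta.comap R.PiY.subtype).map a.toMulEquiv.toMonoidHom =
          R.lDeltaTheta.comap R.PiY.subtype ∧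
        R.augY.ker.map a.toMulEquiv.toMonoidHom = R.augY.ker) :
    R.Cor219_i_subquotients := by
  intro η hη α
  obtain ⟨a, hα, hK, hL, hΔ⟩ := hY η hη α
  exact clauses_of_induced_invariance α hα hK hL hΔ

/-- **F-0627 characterised under F-0623.** If `Ker(Π• ↠ Π•_Y)` is the union of the centralisers
of the open subgroups (`Cor218_iii_quotient`, so that every automorphism of a model induces one of
`Π^tp_Y`), then `Cor219_i_subquotients` holds for `R` IF AND ONLY IF every automorphism of every
model `M(η)` induces an automorphism of `Π^tp_Y` preserving `Ker(Π^tp_Y ↠ (Π^tp_Y)^Θ)`, `l·Δ_Θ`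
and `Δ^tp_Y`. [cite: MochizukiEtTh2009, Cor 2.19(i) p.64] -/
theorem cor219_i_subquotients_iff_induced_invariance (h : R.Cor218_iii_quotient) :
    R.Cor219_i_subquotients ↔
      ∀ (η : R.PiYdd → R.mu) (hη : η ∈ R.thetaCocycles)
        (α : (R.modelMono hη).Iso (R.modelMono hη)),
        ∃ a : R.PiY ≃ₜ* R.PiY, R.Induces α.e.toMulEquiv a ∧
          (R.thetaKer.comap R.PiY.subtype).map a.toMulEquiv.toMonoidHom =
            R.thetaKer.comap R.PiY.subtype ∧
          (R.lDeltaTheta.comap R.PiY.subtype).map a.toMulEquiv.toMonoidHom =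
            R.lDeltaTheta.comap R.PiY.subtype ∧
          R.augY.ker.map a.toMulEquiv.toMonoidHom = R.augY.ker := by
  refine ⟨fun h219 η hη α => ?_, R.cor219_i_subquotients_of_induced_invariance⟩
  obtain ⟨a, hα⟩ := exists_induces_iso h α
  obtain ⟨h1, h2, h3⟩ := h219 η hη α
  exact ⟨a, hα, hα.invariance_of_clauses h1 h2 h3⟩

/-- The induced automorphism being unique (`Induces.unique`), the characterisation may be read with
ANY inducing `a`: under `Cor219_i_subquotients`, every inducing pair `(α, a)` at a model has `a`
preserving the three subquotients. [cite: MochizukiEtTh2009, Cor 2.19(i) p.64] -/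
theorem induced_invariance_of_cor219_i_subquotients (h219 : R.Cor219_i_subquotients)
    {η : R.PiYdd → R.mu} {hη : η ∈ R.thetaCocycles} (α : (R.modelMono hη).Iso (R.modelMono hη))
    {a : R.PiY ≃ₜ* R.PiY} (hα : R.Induces α.e.toMulEquiv a) :
    (R.thetaKer.comap R.PiY.subtype).map a.toMulEquiv.toMonoidHom =
        R.thetaKer.comap R.PiY.subtype ∧
      (R.lDeltaTheta.comap R.PiY.subtype).map a.toMulEquiv.toMonoidHom =
        R.lDeltaTheta.comap R.PiY.subtype ∧
      R.augY.ker.map a.toMulEquiv.toMonoidHom = R.augY.ker :=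
  let ⟨h1, h2, h3⟩ := h219 η hη α
  hα.invariance_of_clauses h1 h2 h3

end RigidData

end Literature.AnabelianGeometry.EtaleTheta
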